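import Literature.AlgebraicGeometry.HodgeTheory.SymmetricA3ReducedChart
import Literature.AlgebraicGeometry.HodgeTheory.SymmetricA3KernelLineJets
import Literature.Analysis.Complex.WeierstrassPreparation
import HarnessLib

/-!
# The symmetric `A₃` point: the reduced chart with its Weierstrass data (two off-axis critical points)
# (programme B2-BIF, stage S3b, for the binder hB2 `picardLefschetz_symmetricA3` of crux K1-B)

Family `hodge`, layer `Literature/AlgebraicGeometry/HodgeTheory`, sequel of `SymmetricA3ReducedChart` (S2: the reduced
chart `(D, x, s)` of the unfolding `f₁ + α g₂ + β g₀`) and `SymmetricA3KernelLineJets` (S3a: chart-free jets along the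
kernel line).  Written by the prover seat `hodge-nonav-prover-Bx` (g12, cell `hodge-nonav`), programme memo
`HOME/memos/PROGRAMME-B2BIF-Bx-g12.md`.

* `IsSymmetricA3Datum.exists_reducedChart_weierstrass` — the reduced chart of S2 together with the first jets of the
  reduced `∂ₖ`-partial `s` at `0` (`s(0) = 0`, `∂_u s(0) = 0`, `∂_α s(0) = κ = ∂ₖ∂ₖg₂(e_j)`, by the kernel-line jets
  applied to the slice-critical curves `t ↦ x((c t, 0), t)`), the order `ord_{u=0} s((0,0), u) = 2` (the `A₃`
  condition `∂ₖ⁴f₁(e_j) ≠ 0`), and WEIERSTRASS DATA for `s` in the variable `u` at the origin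
  (`SCV.exists_weierstrassData`): a polydisc `ball 0 ε × ball 0 R ⊆ D`, radii `0 < r < R` with `s(μ, ·)` zero-free on
  the circle `|u| = r` for `|μ| < ε`, and exactly two roots (with multiplicity) of `s(0, ·)` in `|u| < r`, both at
  `u = 0`.  By `WeierstrassData.card_sliceRoots_eq` every nearby member then has exactly two off-axis slice-critical
  points `u = ±u₀(μ)` near the `A₃` point (AGZV II §5.2: the symmetric `A₃` point splits into the axis node and a pair
  of nodes exchanged by the involution).

## References
* [ArnoldGuseinzadeVarchenko2012] AGZV II, Part I §5.2 (boundary singularities `B_k`, pp. 129–133).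
* [Chirka1989] E. M. Chirka, *Complex Analytic Sets*, §1.1 (Weierstrass data, continuity of roots).
-/

noncomputable section

open MvPolynomial
open _root_.Topology _root_.Filter Set Metric
open Literature.Analysis.Complex.SCV

namespace Literature.AlgebraicGeometry.HodgeTheory

section HodgeTheory

variable {n d : ℕ} {f₁ g₀ g₂ : MvPolynomial (Fin (n + 2)) ℂ} {j k : Fin (n + 2)} {a : Fin (n + 2) → ℂˣ}

namespace IsSymmetricA3Datum

/-- The lines `t ↦ ((c t, 0), t)` through the origin of the parameter space: analyticity, derivative, and the
composites with the chart. [folklore] -/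
private theorem line_facts {D : Set ((ℂ × ℂ) × ℂ)} {xs : (ℂ × ℂ) × ℂ → (Fin (n + 2) → ℂ)} {s : (ℂ × ℂ) × ℂ → ℂ}
    (hDo : IsOpen D) (h0D : (0 : (ℂ × ℂ) × ℂ) ∈ D) (hxsA : AnalyticOnNhd ℂ xs D) (hsd : DifferentiableOn ℂ s D)
    (c : ℂ) :
    AnalyticAt ℂ (fun t : ℂ => xs (((c * t, (0 : ℂ)) : ℂ × ℂ), t)) 0 ∧
      AnalyticAt ℂ (fun t : ℂ => s (((c * t, (0 : ℂ)) : ℂ × ℂ), t)) 0 ∧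
      (∀ᶠ t : ℂ in 𝓝 0, ((((c * t, (0 : ℂ)) : ℂ × ℂ), t) : (ℂ × ℂ) × ℂ) ∈ D) ∧
      HasDerivAt (fun t : ℂ => s (((c * t, (0 : ℂ)) : ℂ × ℂ), t)) (fderiv ℂ s 0 (((c, (0 : ℂ)) : ℂ × ℂ), (1 : ℂ))) 0 := by
  have hℓa : ∀ t : ℂ, AnalyticAt ℂ (fun t : ℂ => ((((c * t, (0 : ℂ)) : ℂ × ℂ), t) : (ℂ × ℂ) × ℂ)) t := fun t =>
    ((analyticAt_const.fun_mul analyticAt_id).prod analyticAt_const).prod analyticAt_id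
  have hℓ0 : ((((c * 0, (0 : ℂ)) : ℂ × ℂ), (0 : ℂ)) : (ℂ × ℂ) × ℂ) = 0 := by
    rw [mul_zero]; rfl
  have hℓc : Continuous fun t : ℂ => ((((c * t, (0 : ℂ)) : ℂ × ℂ), t) : (ℂ × ℂ) × ℂ) :=
    continuous_iff_continuousAt.2 fun t => (hℓa t).continuousAt
  have hpre : IsOpen ((fun t : ℂ => ((((c * t, (0 : ℂ)) : ℂ × ℂ), t) : (ℂ × ℂ) × ℂ)) ⁻¹' D) := hDo.preimage hℓc
  have h0pre : (0 : ℂ) ∈ (fun t : ℂ => ((((c * t, (0 : ℂ)) : ℂ × ℂ), t) : (ℂ × ℂ) × ℂ)) ⁻¹' D := by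
    rw [mem_preimage, hℓ0]; exact h0D
  have hℓD : ∀ᶠ t : ℂ in 𝓝 0, ((((c * t, (0 : ℂ)) : ℂ × ℂ), t) : (ℂ × ℂ) × ℂ) ∈ D := hpre.mem_nhds h0pre
  refine ⟨?_, ?_, hℓD, ?_⟩
  · exact (hxsA 0 h0D).comp_of_eq (hℓa 0) hℓ0
  · have hdiff : DifferentiableOn ℂ (fun t : ℂ => s (((c * t, (0 : ℂ)) : ℂ × ℂ), t))
        ((fun t : ℂ => ((((c * t, (0 : ℂ)) : ℂ × ℂ), t) : (ℂ × ℂ) × ℂ)) ⁻¹' D) :=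
      hsd.comp (fun t _ => (hℓa t).differentiableAt.differentiableWithinAt) fun t ht => ht
    exact hdiff.analyticAt (hpre.mem_nhds h0pre)
  · have hℓd : HasDerivAt (fun t : ℂ => ((((c * t, (0 : ℂ)) : ℂ × ℂ), t) : (ℂ × ℂ) × ℂ))
        ((((c * 1, (0 : ℂ)) : ℂ × ℂ), (1 : ℂ)) : (ℂ × ℂ) × ℂ) 0 :=
      (((hasDerivAt_id' (0 : ℂ)).const_mul c).prodMk (hasDerivAt_const (0 : ℂ) (0 : ℂ))).prodMk (hasDerivAt_id' 0)
    rw [mul_one] at hℓd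
    have hs0 : HasFDerivAt s (fderiv ℂ s 0) 0 := (hsd.differentiableAt (hDo.mem_nhds h0D)).hasFDerivAt
    have h := hs0.comp_hasDerivAt_of_eq (0 : ℂ) hℓd hℓ0.symm
    exact h

/-- **The reduced chart with its jets and Weierstrass data.**  For forms `f₁, g₀, g₂` of degree `d` with
`IsSymmetricA3Datum f₁ g₀ g₂ j k a`, the reduced chart `(D, x, s)` of `IsSymmetricA3Datum.exists_reducedChart` (all of
whose properties are repeated) satisfies moreover: `s(0) = 0`; `∂_u s(0) = 0`; `∂_α s(0) = ∂ₖ∂ₖg₂(e_j)`;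
`s((0,0), ·)` has a zero of order exactly `2` at `u = 0`; and there are `ε > 0`, `0 < r < R` with
`ball 0 ε × ball 0 R ⊆ D`, `WeierstrassData s (ball 0 ε) 0 r R` (no zero of `s(μ, ·)` on `|u| = r` for `|μ| < ε`),
`s(0, u) ≠ 0` for `0 < |u| ≤ r`, and `sliceRoots s 0 r 0 = {0, 0}`.
[cite: ArnoldGuseinzadeVarchenko2012, Part I §5.2] -/
theorem exists_reducedChart_weierstrass (hf₁ : f₁.IsHomogeneous d) (hg₀ : g₀.IsHomogeneous d)
    (hg₂ : g₂.IsHomogeneous d) (hD : IsSymmetricA3Datum f₁ g₀ g₂ j k a) :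
    ∃ (D : Set ((ℂ × ℂ) × ℂ)) (xs : (ℂ × ℂ) × ℂ → (Fin (n + 2) → ℂ)) (s : (ℂ × ℂ) × ℂ → ℂ),
      IsOpen D ∧ (0 : (ℂ × ℂ) × ℂ) ∈ D ∧ AnalyticOnNhd ℂ xs D ∧ DifferentiableOn ℂ s D ∧
      xs 0 = Pi.single j 1 ∧
      (∀ p ∈ D, xs p j = 1 ∧ xs p k = p.2 ∧
        ∀ i, i ≠ j → i ≠ k → eval (xs p) (pderiv i (f₁ + p.1.1 • g₂ + p.1.2 • g₀)) = 0) ∧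
      (∀ p ∈ D, (p.1, -p.2) ∈ D ∧ xs (p.1, -p.2) = (a j : ℂ) • (a • xs p)) ∧
      (∀ p ∈ D, eval (xs p) (pderiv k (f₁ + p.1.1 • g₂ + p.1.2 • g₀)) = p.2 * s p) ∧
      (∀ p ∈ D, s (p.1, -p.2) = s p) ∧
      (∀ p ∈ D, HasFDerivAt (fun q : (ℂ × ℂ) × ℂ => eval (xs q) (f₁ + q.1.1 • g₂ + q.1.2 • g₀))
        (eval (xs p) g₂ • (ContinuousLinearMap.fst ℂ ℂ ℂ).comp (ContinuousLinearMap.fst ℂ (ℂ × ℂ) ℂ) +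
          eval (xs p) g₀ • (ContinuousLinearMap.snd ℂ ℂ ℂ).comp (ContinuousLinearMap.fst ℂ (ℂ × ℂ) ℂ) +
          (p.2 * s p) • ContinuousLinearMap.snd ℂ (ℂ × ℂ) ℂ) p) ∧
      (∃ ρ : ℝ, 0 < ρ ∧ ∀ (μ : ℂ × ℂ) (x : Fin (n + 2) → ℂ), ‖μ‖ < ρ → ‖x - Pi.single j 1‖ < ρ → x j = 1 →
        (∀ i, i ≠ j → i ≠ k → eval x (pderiv i (f₁ + μ.1 • g₂ + μ.2 • g₀)) = 0) →
        (μ, x k) ∈ D ∧ xs (μ, x k) = x) ∧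
      s 0 = 0 ∧
      fderiv ℂ s 0 ((((0 : ℂ), (0 : ℂ)) : ℂ × ℂ), (1 : ℂ)) = 0 ∧
      fderiv ℂ s 0 ((((1 : ℂ), (0 : ℂ)) : ℂ × ℂ), (0 : ℂ)) = eval (Pi.single j (1 : ℂ)) (pderiv k (pderiv k g₂)) ∧
      analyticOrderAt (fun u : ℂ => s ((((0 : ℂ), (0 : ℂ)) : ℂ × ℂ), u)) 0 = 2 ∧
      (∃ ε r R : ℝ, 0 < ε ∧ ball (0 : ℂ × ℂ) ε ×ˢ ball (0 : ℂ) R ⊆ D ∧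
        WeierstrassData s (ball (0 : ℂ × ℂ) ε) 0 r R ∧
        (∀ w ∈ closedBall (0 : ℂ) r, w ≠ 0 → s (0, w) ≠ 0) ∧
        sliceRoots s 0 r 0 = Multiset.replicate 2 0) := by
  classical
  obtain ⟨D, xs, s, hDo, h0D, hxsA, hsd, hxs0, hslice, hE, hdiv, hseven, hgrad, hU⟩ :=
    hD.exists_reducedChart hf₁ hg₀ hg₂
  -- the slice-critical curves along the lines `t ↦ ((c t, 0), t)` and the kernel-line jets
  have hjet : ∀ c : ℂ, s 0 = 0 ∧
      fderiv ℂ s 0 (((c, (0 : ℂ)) : ℂ × ℂ), (1 : ℂ)) = c * eval (Pi.single j (1 : ℂ)) (pderiv k (pderiv k g₂)) := by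
    intro c
    obtain ⟨hya, hσa, hℓD, hσd⟩ := line_facts hDo h0D hxsA hsd c
    have hℓ0 : ((((c * 0, (0 : ℂ)) : ℂ × ℂ), (0 : ℂ)) : (ℂ × ℂ) × ℂ) = 0 := by rw [mul_zero]; rfl
    have hy0 : xs (((c * 0, (0 : ℂ)) : ℂ × ℂ), (0 : ℂ)) = Pi.single j 1 := by rw [hℓ0, hxs0]
    have hyc : ∀ᶠ t : ℂ in 𝓝 0, xs (((c * t, (0 : ℂ)) : ℂ × ℂ), t) j = 1 ∧ xs (((c * t, (0 : ℂ)) : ℂ × ℂ), t) k = t ∧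
        ∀ i, i ≠ j → i ≠ k → eval (xs (((c * t, (0 : ℂ)) : ℂ × ℂ), t)) (pderiv i (f₁ + (c * t) • g₂)) = 0 := by
      refine hℓD.mono fun t ht => ?_
      obtain ⟨h1, h2, h3⟩ := hslice _ ht
      refine ⟨h1, h2, fun i hij hik => ?_⟩
      have := h3 i hij hik
      simp only [zero_smul, add_zero] at this
      exact this
    have hlam : ∀ᶠ t : ℂ in 𝓝 0, eval (xs (((c * t, (0 : ℂ)) : ℂ × ℂ), t)) (pderiv k (f₁ + (c * t) • g₂)) =
        t * s (((c * t, (0 : ℂ)) : ℂ × ℂ), t) := by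
      refine hℓD.mono fun t ht => ?_
      have := hdiv _ ht
      simp only [zero_smul, add_zero] at this
      exact this
    obtain ⟨hσ0, hσ1⟩ := hD.kernelLine_reduced_jets hf₁ c hya hy0 hyc hσa hlam
    refine ⟨?_, ?_⟩
    · rw [← hℓ0]; exact hσ0
    · rw [← hσd.deriv]; exact hσ1
  have hs0 : s 0 = 0 := (hjet 0).1
  have hfu : fderiv ℂ s 0 ((((0 : ℂ), (0 : ℂ)) : ℂ × ℂ), (1 : ℂ)) = 0 := by
    rw [(hjet 0).2, zero_mul]
  have hfα : fderiv ℂ s 0 ((((1 : ℂ), (0 : ℂ)) : ℂ × ℂ), (0 : ℂ)) = eval (Pi.single j (1 : ℂ)) (pderiv k (pderiv k g₂)) := by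
    have h1 := (hjet 1).2
    rw [one_mul] at h1
    have hv : (((((1 : ℂ), (0 : ℂ)) : ℂ × ℂ), (0 : ℂ)) : (ℂ × ℂ) × ℂ) =
        ((((1 : ℂ), (0 : ℂ)) : ℂ × ℂ), (1 : ℂ)) - ((((0 : ℂ), (0 : ℂ)) : ℂ × ℂ), (1 : ℂ)) := by
      ext <;> simp
    rw [hv, map_sub, h1, hfu, sub_zero]
  -- the axis `α = β = 0`: order two in `u`
  have hord : analyticOrderAt (fun u : ℂ => s ((((0 : ℂ), (0 : ℂ)) : ℂ × ℂ), u)) 0 = 2 := by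
    obtain ⟨hya, hσa, hℓD, -⟩ := line_facts hDo h0D hxsA hsd 0
    have hfun1 : (fun t : ℂ => xs ((((0 : ℂ) * t, (0 : ℂ)) : ℂ × ℂ), t)) =
        fun t : ℂ => xs ((((0 : ℂ), (0 : ℂ)) : ℂ × ℂ), t) := by
      funext t; rw [zero_mul]
    have hfun2 : (fun t : ℂ => s ((((0 : ℂ) * t, (0 : ℂ)) : ℂ × ℂ), t)) =
        fun t : ℂ => s ((((0 : ℂ), (0 : ℂ)) : ℂ × ℂ), t) := by
      funext t; rw [zero_mul]
    rw [hfun1] at hya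
    rw [hfun2] at hσa
    have hℓ0 : (((((0 : ℂ), (0 : ℂ)) : ℂ × ℂ), (0 : ℂ)) : (ℂ × ℂ) × ℂ) = 0 := rfl
    have hy0 : xs ((((0 : ℂ), (0 : ℂ)) : ℂ × ℂ), (0 : ℂ)) = Pi.single j 1 := by rw [hℓ0, hxs0]
    have hyc : ∀ᶠ t : ℂ in 𝓝 0, xs ((((0 : ℂ), (0 : ℂ)) : ℂ × ℂ), t) j = 1 ∧
        xs ((((0 : ℂ), (0 : ℂ)) : ℂ × ℂ), t) k = t ∧
        ∀ i, i ≠ j → i ≠ k → eval (xs ((((0 : ℂ), (0 : ℂ)) : ℂ × ℂ), t)) (pderiv i f₁) = 0 := by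
      refine hℓD.mono fun t ht => ?_
      rw [zero_mul] at ht
      obtain ⟨h1, h2, h3⟩ := hslice _ ht
      refine ⟨h1, h2, fun i hij hik => ?_⟩
      have := h3 i hij hik
      simp only [zero_smul, add_zero] at this
      exact this
    have hlam : ∀ᶠ t : ℂ in 𝓝 0, eval (xs ((((0 : ℂ), (0 : ℂ)) : ℂ × ℂ), t)) (pderiv k f₁) =
        t * s ((((0 : ℂ), (0 : ℂ)) : ℂ × ℂ), t) := by
      refine hℓD.mono fun t ht => ?_
      rw [zero_mul] at ht
      have := hdiv _ ht
      simp only [zero_smul, add_zero] at this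
      exact this
    exact (hD.kernelLine_reduced_order_two hf₁ hya hy0 hyc hσa hlam).2.2.2
  -- Weierstrass data in `u` at the origin
  have hW : ∃ ε r R : ℝ, 0 < ε ∧ ball (0 : ℂ × ℂ) ε ×ˢ ball (0 : ℂ) R ⊆ D ∧
      WeierstrassData s (ball (0 : ℂ × ℂ) ε) 0 r R ∧
      (∀ w ∈ closedBall (0 : ℂ) r, w ≠ 0 → s (0, w) ≠ 0) ∧
      sliceRoots s 0 r 0 = Multiset.replicate 2 0 := by
    have h00 : ((0 : ℂ × ℂ), (0 : ℂ)) ∈ D := h0D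
    have hne : ¬ (fun w : ℂ => s ((0 : ℂ × ℂ), w)) =ᶠ[𝓝 (0 : ℂ)] 0 := by
      intro h
      have htop : analyticOrderAt (fun u : ℂ => s ((((0 : ℂ), (0 : ℂ)) : ℂ × ℂ), u)) 0 = ⊤ := by
        rw [analyticOrderAt_eq_top]
        exact h.mono fun w hw => hw
      rw [hord] at htop
      exact ENat.coe_ne_top 2 htop
    obtain ⟨ε, r, R, hε, hsub, hWd, hiso, hroots⟩ := exists_weierstrassData hDo hsd h00 hne
    refine ⟨ε, r, R, hε, hsub, hWd, hiso, ?_⟩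
    rw [hroots]
    congr 1
    have : analyticOrderAt (fun w : ℂ => s ((0 : ℂ × ℂ), w)) 0 = 2 := hord
    rw [analyticOrderNatAt, this]
    rfl
  exact ⟨D, xs, s, hDo, h0D, hxsA, hsd, hxs0, hslice, hE, hdiv, hseven, hgrad, hU, hs0, hfu, hfα, hord, hW⟩

end IsSymmetricA3Datum

end HodgeTheory

end Literature.AlgebraicGeometry.HodgeTheory

end
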